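import Mathlib
import HarnessLib
import Literature.MathematicalPhysics.QuantumFieldTheory.ConstructiveQFTWave0
import Summits.Ventures.LatticeQCDFlow.Scaling.SparsePatchSectorsLattice
import Summits.Ventures.LatticeQCDFlow.Scaling.SpecialUnitaryLocalPaths
import Summits.Ventures.LatticeQCDFlow.Scaling.MetricTunnellingUN
import Summits.Ventures.LatticeQCDFlow.Scaling.LatticePeeling

/-!
# LatticeQCDFlow / Scaling — the SPARSE-PATCH tunnelling law on the lattice, `SU(N)` and `U(N)` instances (v3.2)

HONEST FRAMING: exact (Metropolis-corrected) sampling algorithms for lattice gauge theory; figures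
of merit are autocorrelation/cost numbers at stated couplings and volumes; no continuum-physics
claim.

THEORY-2.md §3.3 / conjecture C7(b), LATTICE PART, §§4–5 of theory-2's item 83 (companion of
`Scaling/SparsePatchSectorsLattice.lean`, which holds §§1–3: `plaqSlot`, the bi-invariant linkwise control
and the generic single-link / sweep laws; LANDING NOTE there: the 432-line item was split at the gate's
400-line limit by the custody seat lean-1 GEN-5, declarations verbatim):

* **`SUN.compProd_sector_ne_le_of_sparseLinks` / `…_of_singleLink` / `SUN.measure_sector_ne_le_nsteps_of_linkSweep`**
  — `G = SU(N)`: there is `r₀ = r₀(N) > 0` (lean-1's local-path radius; NO dependence on `d`, `L`, `β`,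
  `ε`) such that for every `0 ≤ c` with `2c ≤ r₀`, `3c ≤ ε`, every `d ≥ 2`, `L ≥ 2`: an EXACT sampler for ANY
  law `μ` on `SU(N)^E` that updates one link per step (heat bath, overrelaxation, link-Metropolis, any
  proposal + filter) changes the admissibility-`ε` SECTOR with stationary probability
  `≤ 2·μ{some plaquette containing the link has a_p ≥ c}` per step, and `≤ n·2·max_k(…)` per sweep of `n`
  link updates; sparse parallel link sets likewise (`SUN.dist_mul_left/right`: bi-invariance of the
  Hilbert–Schmidt metric; `SUN.exists_localPaths_radius` from `Scaling/SpecialUnitaryLocalPaths.lean`);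
* **`UN.…`** — `G = U(N)` with the EXPLICIT threshold: every `0 ≤ c ≤ 1/16` with `5c ≤ ε` (Cayley-chart local
  paths of `Scaling/MetricTunnellingUN.lean` [cite: arXiv160201222]).

The admissible region `{∀ p, a_p < ε}` has Lüscher's topological sectors as its connected components for
`ε ≤ ε_N` [cite: Luscher1982Topology] — his theorem LABELS the components, the laws do not use it.
No sorry, no new axioms, no `def`.
-/

noncomputable section

open scoped Matrix.Norms.Frobenius ENNReal ProbabilityTheory
open MeasureTheory ProbabilityTheory Metric Set
open Literature.MathematicalPhysics.QuantumFieldTheory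
open Summit.Ventures.LatticeQCDFlow.Theory2.Tunnelling

/-! ## §4. `SU(N)`: bi-invariance, local paths, and the laws with `r₀ = r₀(N)` -/

namespace Summit.Ventures.LatticeQCDFlow.Theory2.Lattice.SUN

open Summit.Ventures.LatticeQCDFlow.Theory2.Lattice

variable {N : ℕ}

/-- Left invariance of the Hilbert–Schmidt distance on `SU(N)`. [folklore] -/
theorem dist_mul_left (U V W : Matrix.specialUnitaryGroup (Fin N) ℂ) : dist (U * V) (U * W) = dist V W := by
  have hU : (U : Matrix (Fin N) (Fin N) ℂ) ∈ Matrix.unitaryGroup (Fin N) ℂ :=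
    (Matrix.mem_specialUnitaryGroup_iff.mp U.2).1
  rw [Subtype.dist_eq, Subtype.dist_eq, dist_eq_norm, dist_eq_norm]
  have e : ((U * V : Matrix.specialUnitaryGroup (Fin N) ℂ) : Matrix (Fin N) (Fin N) ℂ) -
      ((U * W : Matrix.specialUnitaryGroup (Fin N) ℂ) : Matrix (Fin N) (Fin N) ℂ) =
      ((⟨(U : Matrix (Fin N) (Fin N) ℂ), hU⟩ : Matrix.unitaryGroup (Fin N) ℂ) : Matrix (Fin N) (Fin N) ℂ) *
        ((V : Matrix (Fin N) (Fin N) ℂ) - W) := by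
    show (U : Matrix (Fin N) (Fin N) ℂ) * V - U * W = (U : Matrix (Fin N) (Fin N) ℂ) * (V - W)
    rw [Matrix.mul_sub]
  rw [e, Matrix.frobenius_norm_unitaryGroup_mul]

/-- Right invariance of the Hilbert–Schmidt distance on `SU(N)`. [folklore] -/
theorem dist_mul_right (U V W : Matrix.specialUnitaryGroup (Fin N) ℂ) : dist (U * W) (V * W) = dist U V := by
  have hW : (W : Matrix (Fin N) (Fin N) ℂ) ∈ Matrix.unitaryGroup (Fin N) ℂ :=
    (Matrix.mem_specialUnitaryGroup_iff.mp W.2).1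
  rw [Subtype.dist_eq, Subtype.dist_eq, dist_eq_norm, dist_eq_norm]
  have e : ((U * W : Matrix.specialUnitaryGroup (Fin N) ℂ) : Matrix (Fin N) (Fin N) ℂ) -
      ((V * W : Matrix.specialUnitaryGroup (Fin N) ℂ) : Matrix (Fin N) (Fin N) ℂ) =
      ((U : Matrix (Fin N) (Fin N) ℂ) - V) *
        ((⟨(W : Matrix (Fin N) (Fin N) ℂ), hW⟩ : Matrix.unitaryGroup (Fin N) ℂ) : Matrix (Fin N) (Fin N) ℂ) := by
    show (U : Matrix (Fin N) (Fin N) ℂ) * W - V * W = ((U : Matrix (Fin N) (Fin N) ℂ) - V) * W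
    rw [Matrix.sub_mul]
  rw [e, Matrix.frobenius_norm_mul_unitaryGroup]

/-- `(ρ, ρ)`-local paths on `SU(N)` for every `ρ ≤ r₀(N)` (lean-1's `exists_localPath`). [folklore] -/
theorem exists_localPaths_radius : ∃ r₀ : ℝ, 0 < r₀ ∧ ∀ ρ : ℝ, ρ ≤ r₀ →
    ∀ U V : Matrix.specialUnitaryGroup (Fin N) ℂ, dist U V ≤ ρ →
      ∃ γ : ℝ → Matrix.specialUnitaryGroup (Fin N) ℂ, ContinuousOn γ (Icc (0 : ℝ) 1) ∧ γ 0 = U ∧ γ 1 = V ∧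
        ∀ t ∈ Icc (0 : ℝ) 1, dist (γ t) U ≤ ρ := by
  obtain ⟨r₀, hr₀, hpath⟩ := exists_localPath (N := N)
  refine ⟨r₀, hr₀, fun ρ hρ U V hUV => ?_⟩
  obtain ⟨γ, hγc, hγ0, hγ1, hγd⟩ := hpath U V (hUV.trans hρ)
  exact ⟨γ, hγc, hγ0, hγ1, fun t ht => (hγd t ht).trans hUV⟩

/-- **`SU(N)` sparse-links tunnelling law.**  There is `r₀ > 0` depending on `N` only such that for all
`0 ≤ c` with `2c ≤ r₀` and `3c ≤ ε`, every `d ≥ 2`, every `L`, every plaquette-sparse link set `Λ`, every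
s-finite `μ` on `SU(N)^E` and every `μ`-invariant Markov kernel whose moves a.s. change only links of `Λ`:
`(μ ⊗ₘ κ){sector_ε ≠ sector_ε'} ≤ 2·μ{∃ p with a slot in Λ, dist (U_p, 1) ≥ c}`. [folklore] -/
theorem compProd_sector_ne_le_of_sparseLinks : ∃ r₀ : ℝ, 0 < r₀ ∧ ∀ c ε : ℝ, 0 ≤ c → 2 * c ≤ r₀ →
    3 * c ≤ ε → ∀ {d L : ℕ}, 2 ≤ d → ∀ {Λ : Set (Edge d L)},
      (∀ (p : Plaquette d L) (s s' : Fin 4), plaqSlot p s ∈ Λ → plaqSlot p s' ∈ Λ → s = s') →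
      ∀ (μ : Measure (GaugeConfig d L (Matrix.specialUnitaryGroup (Fin N) ℂ))) [SFinite μ]
        (κ : Kernel (GaugeConfig d L (Matrix.specialUnitaryGroup (Fin N) ℂ))
          (GaugeConfig d L (Matrix.specialUnitaryGroup (Fin N) ℂ))) [IsMarkovKernel κ],
        κ.Invariant μ → (∀ᵐ q ∂(μ ⊗ₘ κ), ∀ e ∉ Λ, q.1 e = q.2 e) →
        (μ ⊗ₘ κ) {q | connectedComponentIn
              {W | ∀ p : Plaquette d L, dist (plaquetteHolonomy W p.1 p.2.1.1 p.2.1.2) 1 < ε} q.1 ≠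
            connectedComponentIn
              {W | ∀ p : Plaquette d L, dist (plaquetteHolonomy W p.1 p.2.1.1 p.2.1.2) 1 < ε} q.2} ≤
          2 * μ {U | ∃ (p : Plaquette d L) (s : Fin 4), plaqSlot p s ∈ Λ ∧
            c ≤ dist (plaquetteHolonomy U p.1 p.2.1.1 p.2.1.2) 1} := by
  obtain ⟨r₀, hr₀, hpath⟩ := exists_localPaths_radius (N := N)
  refine ⟨r₀, hr₀, fun c ε hc0 hc hcε d L hd Λ hΛ μ _ κ _ hinv hmove => ?_⟩
  exact Lattice.compProd_sector_ne_le_of_sparseLinks hd dist_mul_left dist_mul_right (r := 2 * c)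
    (by linarith) (hpath (2 * c) hc) (le_refl _) (by linarith) hΛ μ κ hinv hmove

/-- **`SU(N)` single-link tunnelling law** (`d ≥ 2`, `L ≥ 2`; heat bath / overrelaxation / link
Metropolis / any exact single-link update for any law `μ`):
`(μ ⊗ₘ κ){sector_ε ≠ sector_ε'} ≤ 2·μ{some plaquette containing e₀ has dist (U_p, 1) ≥ c}`. [folklore] -/
theorem compProd_sector_ne_le_of_singleLink : ∃ r₀ : ℝ, 0 < r₀ ∧ ∀ c ε : ℝ, 0 ≤ c → 2 * c ≤ r₀ →
    3 * c ≤ ε → ∀ {d L : ℕ} [NeZero L], 2 ≤ d → 2 ≤ L → ∀ (e₀ : Edge d L)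
      (μ : Measure (GaugeConfig d L (Matrix.specialUnitaryGroup (Fin N) ℂ))) [SFinite μ]
      (κ : Kernel (GaugeConfig d L (Matrix.specialUnitaryGroup (Fin N) ℂ))
        (GaugeConfig d L (Matrix.specialUnitaryGroup (Fin N) ℂ))) [IsMarkovKernel κ],
      κ.Invariant μ → (∀ᵐ q ∂(μ ⊗ₘ κ), ∀ e, e ≠ e₀ → q.1 e = q.2 e) →
        (μ ⊗ₘ κ) {q | connectedComponentIn
              {W | ∀ p : Plaquette d L, dist (plaquetteHolonomy W p.1 p.2.1.1 p.2.1.2) 1 < ε} q.1 ≠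
            connectedComponentIn
              {W | ∀ p : Plaquette d L, dist (plaquetteHolonomy W p.1 p.2.1.1 p.2.1.2) 1 < ε} q.2} ≤
          2 * μ {U | ∃ (p : Plaquette d L) (s : Fin 4), plaqSlot p s = e₀ ∧
            c ≤ dist (plaquetteHolonomy U p.1 p.2.1.1 p.2.1.2) 1} := by
  obtain ⟨r₀, hr₀, hpath⟩ := exists_localPaths_radius (N := N)
  refine ⟨r₀, hr₀, fun c ε hc0 hc hcε d L _ hd hL e₀ μ _ κ _ hinv hmove => ?_⟩
  exact Lattice.compProd_sector_ne_le_of_singleLink hd hL dist_mul_left dist_mul_right (r := 2 * c)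
    (by linarith) (hpath (2 * c) hc) (le_refl _) (by linarith) e₀ μ κ hinv hmove

/-- **`SU(N)` link-sweep law** (`d ≥ 2`, `L ≥ 2`): over `n` steps of a stationary single-link sampler (link
`e k` at step `k`, one-time marginals `m`) the sector changes with probability `≤ n·2·M`,
`M ≥ max_k m{some plaquette containing e k has dist (U_p, 1) ≥ c}`. [folklore] -/
theorem measure_sector_ne_le_nsteps_of_linkSweep : ∃ r₀ : ℝ, 0 < r₀ ∧ ∀ c ε : ℝ, 0 ≤ c → 2 * c ≤ r₀ →
    3 * c ≤ ε → ∀ {d L : ℕ} [NeZero L], 2 ≤ d → 2 ≤ L → ∀ (e : ℕ → Edge d L) {Ω : Type*} [MeasurableSpace Ω]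
      (P : Measure Ω) (Z : ℕ → Ω → GaugeConfig d L (Matrix.specialUnitaryGroup (Fin N) ℂ)),
      (∀ k, Measurable (Z k)) → ∀ m : Measure (GaugeConfig d L (Matrix.specialUnitaryGroup (Fin N) ℂ)),
      (∀ k, P.map (Z k) = m) → (∀ k, ∀ᵐ ω ∂P, ∀ e', e' ≠ e k → Z k ω e' = Z (k + 1) ω e') →
      ∀ {M : ℝ≥0∞}, (∀ k, m {U | ∃ (p : Plaquette d L) (s : Fin 4), plaqSlot p s = e k ∧
        c ≤ dist (plaquetteHolonomy U p.1 p.2.1.1 p.2.1.2) 1} ≤ M) → ∀ n : ℕ,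
        P {ω | connectedComponentIn
              {W | ∀ p : Plaquette d L, dist (plaquetteHolonomy W p.1 p.2.1.1 p.2.1.2) 1 < ε} (Z n ω) ≠
            connectedComponentIn
              {W | ∀ p : Plaquette d L, dist (plaquetteHolonomy W p.1 p.2.1.1 p.2.1.2) 1 < ε} (Z 0 ω)} ≤
          n * (2 * M) := by
  obtain ⟨r₀, hr₀, hpath⟩ := exists_localPaths_radius (N := N)
  refine ⟨r₀, hr₀, fun c ε hc0 hc hcε d L _ hd hL e Ω _ P Z hZ m hmarg hstep M hM n => ?_⟩
  exact Lattice.measure_sector_ne_le_nsteps_of_linkSweep hd hL dist_mul_left dist_mul_right (r := 2 * c)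
    (by linarith) (hpath (2 * c) hc) (le_refl _) (by linarith) e P Z hZ m hmarg hstep hM n

end Summit.Ventures.LatticeQCDFlow.Theory2.Lattice.SUN

/-! ## §5. `U(N)`: the explicit threshold `c ≤ min(ε/5, 1/16)` -/

namespace Summit.Ventures.LatticeQCDFlow.Theory2.Lattice.UN

open Summit.Ventures.LatticeQCDFlow.Theory2.Lattice
open Literature.MathematicalPhysics.QuantumFieldTheory.UnitaryCayley (𝔾)

variable {N : ℕ}

/-- Right invariance of the Hilbert–Schmidt distance on `U(N)`. [folklore] -/
theorem dist_mul_right (U V W : 𝔾 N) : dist (U * W) (V * W) = dist U V := by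
  rw [Subtype.dist_eq, Subtype.dist_eq, dist_eq_norm, dist_eq_norm]
  have h := Matrix.frobenius_norm_mul_unitaryGroup
    ((U : Matrix (Fin N) (Fin N) ℂ) - (V : Matrix (Fin N) (Fin N) ℂ)) W
  rw [Matrix.sub_mul] at h
  exact h

/-- **`U(N)` single-link tunnelling law with an explicit threshold**: for every `0 ≤ c ≤ 1/16` with
`5c ≤ ε`, `d ≥ 2`, `L ≥ 2`, every s-finite `μ` on `U(N)^E` and every `μ`-invariant single-link Markov
kernel: `(μ ⊗ₘ κ){sector_ε ≠ sector_ε'} ≤ 2·μ{some plaquette containing e₀ has dist (U_p, 1) ≥ c}`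
(Cayley-chart local paths of radii `(2c, 4c)`). [folklore] -/
theorem compProd_sector_ne_le_of_singleLink {c ε : ℝ} (hc0 : 0 ≤ c) (hc : c ≤ 1 / 16) (hcε : 5 * c ≤ ε)
    {d L : ℕ} [NeZero L] (hd : 2 ≤ d) (hL : 2 ≤ L) (e₀ : Edge d L)
    (μ : Measure (GaugeConfig d L (𝔾 N))) [SFinite μ]
    (κ : Kernel (GaugeConfig d L (𝔾 N)) (GaugeConfig d L (𝔾 N))) [IsMarkovKernel κ] (hinv : κ.Invariant μ)
    (hmove : ∀ᵐ q ∂(μ ⊗ₘ κ), ∀ e, e ≠ e₀ → q.1 e = q.2 e) :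
    (μ ⊗ₘ κ) {q | connectedComponentIn
          {W : GaugeConfig d L (𝔾 N) | ∀ p : Plaquette d L, dist (plaquetteHolonomy W p.1 p.2.1.1 p.2.1.2) 1 < ε} q.1 ≠
        connectedComponentIn
          {W : GaugeConfig d L (𝔾 N) | ∀ p : Plaquette d L, dist (plaquetteHolonomy W p.1 p.2.1.1 p.2.1.2) 1 < ε} q.2} ≤
      2 * μ {U | ∃ (p : Plaquette d L) (s : Fin 4), plaqSlot p s = e₀ ∧
        c ≤ dist (plaquetteHolonomy U p.1 p.2.1.1 p.2.1.2) 1} :=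
  Lattice.compProd_sector_ne_le_of_singleLink hd hL dist_mul_left dist_mul_right (ρ := 2 * c) (r := 2 * (2 * c))
    (by positivity) (fun g g' h => exists_localPaths (by positivity) (by linarith) g g' h) (le_refl _)
    (by linarith) e₀ μ κ hinv hmove

/-- **`U(N)` link-sweep law with an explicit threshold** (`0 ≤ c ≤ 1/16`, `5c ≤ ε`). [folklore] -/
theorem measure_sector_ne_le_nsteps_of_linkSweep {c ε : ℝ} (hc0 : 0 ≤ c) (hc : c ≤ 1 / 16)
    (hcε : 5 * c ≤ ε) {d L : ℕ} [NeZero L] (hd : 2 ≤ d) (hL : 2 ≤ L) (e : ℕ → Edge d L)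
    {Ω : Type*} [MeasurableSpace Ω] (P : Measure Ω) (Z : ℕ → Ω → GaugeConfig d L (𝔾 N))
    (hZ : ∀ k, Measurable (Z k)) (m : Measure (GaugeConfig d L (𝔾 N))) (hmarg : ∀ k, P.map (Z k) = m)
    (hstep : ∀ k, ∀ᵐ ω ∂P, ∀ e', e' ≠ e k → Z k ω e' = Z (k + 1) ω e') {M : ℝ≥0∞}
    (hM : ∀ k, m {U | ∃ (p : Plaquette d L) (s : Fin 4), plaqSlot p s = e k ∧
      c ≤ dist (plaquetteHolonomy U p.1 p.2.1.1 p.2.1.2) 1} ≤ M) (n : ℕ) :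
    P {ω | connectedComponentIn
          {W : GaugeConfig d L (𝔾 N) | ∀ p : Plaquette d L, dist (plaquetteHolonomy W p.1 p.2.1.1 p.2.1.2) 1 < ε} (Z n ω) ≠
        connectedComponentIn
          {W : GaugeConfig d L (𝔾 N) | ∀ p : Plaquette d L, dist (plaquetteHolonomy W p.1 p.2.1.1 p.2.1.2) 1 < ε} (Z 0 ω)} ≤
      n * (2 * M) :=
  Lattice.measure_sector_ne_le_nsteps_of_linkSweep hd hL dist_mul_left dist_mul_right (ρ := 2 * c)
    (r := 2 * (2 * c)) (by positivity) (fun g g' h => exists_localPaths (by positivity) (by linarith) g g' h)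
    (le_refl _) (by linarith) e P Z hZ m hmarg hstep hM n

end Summit.Ventures.LatticeQCDFlow.Theory2.Lattice.UN
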